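import Summits.MatrixMultiplication.MatrixMultiplication.Theorems.SoloInformedValBlockStability

/-!
# SoloInformedValNearPerfect — a complete block of volume `v` caps the number of triangles at `v + 3(|G| - v)²`

Sequel of `SoloInformedValBlockStability` (same notation; K. Pratt, arXiv:2309.03878, Def. 3.2 for the ambient
notion of equilateral trapezoid-free triples, of which the normal-form configurations without accidental
solutions are the structured instances).

`SoloInformedValPerfectBlock` showed that a PERFECT block (`v = |I₀||J₀||K₀| = |G|`) is rigid (`T = |G|`), and
`SoloInformedValBlockStability` that a complete block of volume `v` leaves room for at most `r = |G| - v` new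
triangle-supporting edges in each of the three pair graphs.  Here the two are combined into a bound on the
number `T` of triangles of the whole configuration:

* `NoAccidental.card_triangleSet_le_nearPerfect`: `T ≤ v + 3 r²` (`r = |G| - v`), for every complete block with
  nonempty sides in a configuration without accidental solutions.

So NEAR-PERFECT blocks are nearly rigid: a configuration containing a complete block of volume `|G| - r` has at
most `|G| - r + 3r²` triangles; for `r = 0` this is `T ≤ |G|` again.

PROOF.  A triangle inside the block is a cell of the block (`≤ v` of them).  A triangle `(i,j,k)` NOT inside the
block has a vertex outside; the two edges of the triangle at that vertex are NEW triangle-supporting edges of two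
different pair graphs, and they determine the triangle.  Hence the outside triangles inject into
`E_IJ × E_KI ∪ E_IJ × E_JK ∪ E_JK × E_KI` (`E_XY` = new triangle-supporting edges of `H_XY`), whose size is at most
`3r²` by the stability bounds `#E_XY ≤ r`.

solo-informed MatrixMultiplication, gen 76 (dossier `paper/val-superlinear.md` (15.7)(i)).  Elementary; no
`sorry`, no new definitions.
-/

namespace Summit.MatrixMultiplication.MatrixMultiplication.Theorems.SoloVal

open Finset

section NearPerfect

variable {G : Type*} [AddCommGroup G]
variable {I J K : Type*}
variable {x : I → G} {y : J → G} {z : K → G}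
variable {HIJ : Finset (I × J)} {HJK : Finset (J × K)} {HKI : Finset (K × I)}
variable {I₀ : Finset I} {J₀ : Finset J} {K₀ : Finset K}

/-- The triangles inside a complete block are cells of the block: at most `|I₀||J₀||K₀|` of them. -/
theorem card_triangleSet_filter_block_le [DecidableEq I] [DecidableEq J] [DecidableEq K] :
    ((triangleSet HIJ HJK HKI).filter (fun τ => τ.1 ∈ I₀ ∧ τ.2.1 ∈ J₀ ∧ τ.2.2 ∈ K₀)).card
      ≤ I₀.card * J₀.card * K₀.card := by
  calc ((triangleSet HIJ HJK HKI).filter (fun τ => τ.1 ∈ I₀ ∧ τ.2.1 ∈ J₀ ∧ τ.2.2 ∈ K₀)).card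
      ≤ (I₀ ×ˢ (J₀ ×ˢ K₀)).card := by
        apply Finset.card_le_card
        intro τ hτ
        rw [Finset.mem_filter] at hτ
        rw [Finset.mem_product, Finset.mem_product]
        exact hτ.2
    _ = I₀.card * J₀.card * K₀.card := by
        rw [Finset.card_product, Finset.card_product, mul_assoc]

/-- The triangles NOT inside the block inject into pairs of new triangle-supporting edges at the outside vertex:
their number is at most `#E_IJ · #E_KI + #E_IJ · #E_JK + #E_JK · #E_KI`. -/
theorem card_triangleSet_filter_not_block_le [DecidableEq I] [DecidableEq J] [DecidableEq K] :
    ((triangleSet HIJ HJK HKI).filter (fun τ => ¬ (τ.1 ∈ I₀ ∧ τ.2.1 ∈ J₀ ∧ τ.2.2 ∈ K₀))).card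
      ≤ (((triangleSet HIJ HJK HKI).image (fun τ : I × J × K => (τ.1, τ.2.1))).filter
            (fun e => ¬ (e.1 ∈ I₀ ∧ e.2 ∈ J₀))).card
          * (((triangleSet HIJ HJK HKI).image (fun τ : I × J × K => (τ.2.2, τ.1))).filter
            (fun e => ¬ (e.1 ∈ K₀ ∧ e.2 ∈ I₀))).card
        + (((triangleSet HIJ HJK HKI).image (fun τ : I × J × K => (τ.1, τ.2.1))).filter
            (fun e => ¬ (e.1 ∈ I₀ ∧ e.2 ∈ J₀))).card
          * (((triangleSet HIJ HJK HKI).image (fun τ : I × J × K => (τ.2.1, τ.2.2))).filter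
            (fun e => ¬ (e.1 ∈ J₀ ∧ e.2 ∈ K₀))).card
        + (((triangleSet HIJ HJK HKI).image (fun τ : I × J × K => (τ.2.1, τ.2.2))).filter
            (fun e => ¬ (e.1 ∈ J₀ ∧ e.2 ∈ K₀))).card
          * (((triangleSet HIJ HJK HKI).image (fun τ : I × J × K => (τ.2.2, τ.1))).filter
            (fun e => ¬ (e.1 ∈ K₀ ∧ e.2 ∈ I₀))).card := by
  set Tr := triangleSet HIJ HJK HKI with hTr
  set EIJ := (Tr.image (fun τ : I × J × K => (τ.1, τ.2.1))).filter (fun e => ¬ (e.1 ∈ I₀ ∧ e.2 ∈ J₀))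
    with hEIJ
  set EJK := (Tr.image (fun τ : I × J × K => (τ.2.1, τ.2.2))).filter (fun e => ¬ (e.1 ∈ J₀ ∧ e.2 ∈ K₀))
    with hEJK
  set EKI := (Tr.image (fun τ : I × J × K => (τ.2.2, τ.1))).filter (fun e => ¬ (e.1 ∈ K₀ ∧ e.2 ∈ I₀))
    with hEKI
  -- the three families of pairs
  set S₁ := (EIJ ×ˢ EKI).image (fun p : (I × J) × (K × I) => (p.1.1, p.1.2, p.2.1)) with hS₁
  set S₂ := (EIJ ×ˢ EJK).image (fun p : (I × J) × (J × K) => (p.1.1, p.1.2, p.2.2)) with hS₂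
  set S₃ := (EJK ×ˢ EKI).image (fun p : (J × K) × (K × I) => (p.2.2, p.1.1, p.1.2)) with hS₃
  have hsub : Tr.filter (fun τ => ¬ (τ.1 ∈ I₀ ∧ τ.2.1 ∈ J₀ ∧ τ.2.2 ∈ K₀)) ⊆ S₁ ∪ S₂ ∪ S₃ := by
    rintro ⟨i, j, k⟩ hτ
    rw [Finset.mem_filter] at hτ
    obtain ⟨hT, hout⟩ := hτ
    have eIJ : (i, j) ∈ Tr.image (fun τ : I × J × K => (τ.1, τ.2.1)) :=
      Finset.mem_image.mpr ⟨(i, j, k), hT, rfl⟩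
    have eJK : (j, k) ∈ Tr.image (fun τ : I × J × K => (τ.2.1, τ.2.2)) :=
      Finset.mem_image.mpr ⟨(i, j, k), hT, rfl⟩
    have eKI : (k, i) ∈ Tr.image (fun τ : I × J × K => (τ.2.2, τ.1)) :=
      Finset.mem_image.mpr ⟨(i, j, k), hT, rfl⟩
    simp only at hout
    rw [Finset.mem_union, Finset.mem_union]
    by_cases hi : i ∈ I₀
    · by_cases hj : j ∈ J₀
      · -- then `k ∉ K₀`: the two edges at `k` are new
        have hk : k ∉ K₀ := fun hk => hout ⟨hi, hj, hk⟩
        right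
        refine Finset.mem_image.mpr ⟨((j, k), (k, i)), ?_, rfl⟩
        rw [Finset.mem_product]
        exact ⟨Finset.mem_filter.mpr ⟨eJK, fun h => hk h.2⟩, Finset.mem_filter.mpr ⟨eKI, fun h => hk h.1⟩⟩
      · -- `j ∉ J₀`: the two edges at `j` are new
        left; right
        refine Finset.mem_image.mpr ⟨((i, j), (j, k)), ?_, rfl⟩
        rw [Finset.mem_product]
        exact ⟨Finset.mem_filter.mpr ⟨eIJ, fun h => hj h.2⟩, Finset.mem_filter.mpr ⟨eJK, fun h => hj h.1⟩⟩
    · -- `i ∉ I₀`: the two edges at `i` are new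
      left; left
      refine Finset.mem_image.mpr ⟨((i, j), (k, i)), ?_, rfl⟩
      rw [Finset.mem_product]
      exact ⟨Finset.mem_filter.mpr ⟨eIJ, fun h => hi h.1⟩, Finset.mem_filter.mpr ⟨eKI, fun h => hi h.2⟩⟩
  calc (Tr.filter (fun τ => ¬ (τ.1 ∈ I₀ ∧ τ.2.1 ∈ J₀ ∧ τ.2.2 ∈ K₀))).card
      ≤ (S₁ ∪ S₂ ∪ S₃).card := Finset.card_le_card hsub
    _ ≤ S₁.card + S₂.card + S₃.card :=
        (Finset.card_union_le _ _).trans (Nat.add_le_add_right (Finset.card_union_le _ _) _)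
    _ ≤ EIJ.card * EKI.card + EIJ.card * EJK.card + EJK.card * EKI.card := by
        refine Nat.add_le_add (Nat.add_le_add ?_ ?_) ?_
        · exact Finset.card_image_le.trans (Finset.card_product _ _).le
        · exact Finset.card_image_le.trans (Finset.card_product _ _).le
        · exact Finset.card_image_le.trans (Finset.card_product _ _).le

/-- NEAR-PERFECT BLOCKS ARE NEARLY RIGID.  With no accidental solutions and a complete block `I₀ × J₀ × K₀`
with nonempty sides and volume `v = |I₀||J₀||K₀|`, the number of triangles of the whole configuration is at
most `v + 3 (|G| - v)²`. -/
theorem NoAccidental.card_triangleSet_le_nearPerfect [Fintype G] [DecidableEq G]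
    [DecidableEq I] [DecidableEq J] [DecidableEq K]
    (hN : NoAccidental x y z HIJ HJK HKI)
    (hIJ : ∀ i ∈ I₀, ∀ j ∈ J₀, (i, j) ∈ HIJ) (hJK : ∀ j ∈ J₀, ∀ k ∈ K₀, (j, k) ∈ HJK)
    (hKI : ∀ k ∈ K₀, ∀ i ∈ I₀, (k, i) ∈ HKI)
    (hI₀ : I₀.Nonempty) (hJ₀ : J₀.Nonempty) (hK₀ : K₀.Nonempty) :
    (triangleSet HIJ HJK HKI).card
      ≤ I₀.card * J₀.card * K₀.card
        + 3 * (Fintype.card G - I₀.card * J₀.card * K₀.card) ^ 2 := by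
  set Tr := triangleSet HIJ HJK HKI with hTr
  set v := I₀.card * J₀.card * K₀.card with hv
  set EIJ := (Tr.image (fun τ : I × J × K => (τ.1, τ.2.1))).filter (fun e => ¬ (e.1 ∈ I₀ ∧ e.2 ∈ J₀))
    with hEIJ
  set EJK := (Tr.image (fun τ : I × J × K => (τ.2.1, τ.2.2))).filter (fun e => ¬ (e.1 ∈ J₀ ∧ e.2 ∈ K₀))
    with hEJK
  set EKI := (Tr.image (fun τ : I × J × K => (τ.2.2, τ.1))).filter (fun e => ¬ (e.1 ∈ K₀ ∧ e.2 ∈ I₀))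
    with hEKI
  -- stability: each family of new triangle-supporting edges has at most `|G| - v` members
  have bIJ : EIJ.card + v ≤ Fintype.card G := by
    refine hN.card_newEdgesIJ_add_le hIJ hJK hKI hK₀ EIJ ?_ ?_
    · intro e he
      obtain ⟨⟨i, j, k⟩, hτ, rfl⟩ := Finset.mem_image.mp (Finset.mem_filter.mp he).1
      exact ⟨k, mem_triangleSet.mp hτ⟩
    · intro e he
      exact (Finset.mem_filter.mp he).2
  have bJK : EJK.card + v ≤ Fintype.card G := by
    refine hN.card_newEdgesJK_add_le hIJ hJK hKI hI₀ EJK ?_ ?_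
    · intro e he
      obtain ⟨⟨i, j, k⟩, hτ, rfl⟩ := Finset.mem_image.mp (Finset.mem_filter.mp he).1
      exact ⟨i, mem_triangleSet.mp hτ⟩
    · intro e he
      exact (Finset.mem_filter.mp he).2
  have bKI : EKI.card + v ≤ Fintype.card G := by
    refine hN.card_newEdgesKI_add_le hIJ hJK hKI hJ₀ EKI ?_ ?_
    · intro e he
      obtain ⟨⟨i, j, k⟩, hτ, rfl⟩ := Finset.mem_image.mp (Finset.mem_filter.mp he).1
      exact ⟨j, mem_triangleSet.mp hτ⟩
    · intro e he
      exact (Finset.mem_filter.mp he).2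
  have aIJ : EIJ.card ≤ Fintype.card G - v := Nat.le_sub_of_add_le bIJ
  have aJK : EJK.card ≤ Fintype.card G - v := Nat.le_sub_of_add_le bJK
  have aKI : EKI.card ≤ Fintype.card G - v := Nat.le_sub_of_add_le bKI
  have hsplit := Finset.card_filter_add_card_filter_not
    (s := Tr) (fun τ : I × J × K => τ.1 ∈ I₀ ∧ τ.2.1 ∈ J₀ ∧ τ.2.2 ∈ K₀)
  have hin := card_triangleSet_filter_block_le (HIJ := HIJ) (HJK := HJK) (HKI := HKI)
    (I₀ := I₀) (J₀ := J₀) (K₀ := K₀)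
  have hout := card_triangleSet_filter_not_block_le (HIJ := HIJ) (HJK := HJK) (HKI := HKI)
    (I₀ := I₀) (J₀ := J₀) (K₀ := K₀)
  rw [← hTr] at hin hout
  rw [← hEIJ, ← hEJK, ← hEKI] at hout
  have hprod : EIJ.card * EKI.card + EIJ.card * EJK.card + EJK.card * EKI.card
      ≤ 3 * (Fintype.card G - v) ^ 2 := by
    have h1 := Nat.mul_le_mul aIJ aKI
    have h2 := Nat.mul_le_mul aIJ aJK
    have h3 := Nat.mul_le_mul aJK aKI
    rw [sq]
    omega
  omega

/-- In particular a near-perfect block of volume `|G| - r` allows at most `|G| - r + 3 r²` triangles; for `r = 0`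
this is the rigidity bound `T ≤ |G|`. -/
theorem NoAccidental.card_triangleSet_le_of_perfectBlock' [Fintype G] [DecidableEq G]
    [DecidableEq I] [DecidableEq J] [DecidableEq K]
    (hN : NoAccidental x y z HIJ HJK HKI)
    (hIJ : ∀ i ∈ I₀, ∀ j ∈ J₀, (i, j) ∈ HIJ) (hJK : ∀ j ∈ J₀, ∀ k ∈ K₀, (j, k) ∈ HJK)
    (hKI : ∀ k ∈ K₀, ∀ i ∈ I₀, (k, i) ∈ HKI)
    (hI₀ : I₀.Nonempty) (hJ₀ : J₀.Nonempty) (hK₀ : K₀.Nonempty)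
    (hcard : I₀.card * J₀.card * K₀.card = Fintype.card G) :
    (triangleSet HIJ HJK HKI).card ≤ Fintype.card G := by
  have h := hN.card_triangleSet_le_nearPerfect hIJ hJK hKI hI₀ hJ₀ hK₀
  rw [hcard, Nat.sub_self] at h
  simpa using h

end NearPerfect

end Summit.MatrixMultiplication.MatrixMultiplication.Theorems.SoloVal
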